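import Summits.HubbardSuperconductivity.HubbardSuperconductivity.Theses.KLProgramme
import Summits.HubbardSuperconductivity.HubbardSuperconductivity.Theorems.KLProgrammeH10TwoPointLimitVitaliLineNearZero

/-!
K1 SKELETON «vitali» (lead leafhand-hubbard-klprogramme-2 g0, 2026-08-30; SECOND line for stmt-HubbardSuperconductivity-19938, stored
as a crux workfile, NOT registered — the registered stub set of record stays `Lines/children_v4.lean` = the live K3 children 20437/23356).

ONE stub: the `L`-uniform COMPLEX-COUPLING bound («sausage bound») — for every `μ` in the analysis window, `β > 0`, sites/spins, an open
preconnected `Ω ∋ 0` containing every admissible real coupling `0 < U ≤ U₀`, `β ≤ e^{a/U}`, holomorphic `G_L` (`L ≥ L₀`) uniformly bounded on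
`Ω` whose real trace is the finite-volume two-point function (= BGM 2006 Thm 2.1-type n!-free bounds of the sign-blind multiscale expansion at
`|u| log β ≤ 2a`, run at complex coupling `|Im u| ≲ κ/β`; the tree's R0 core `…H10RungBetaUCorner.R0_core` is this statement on the DISC
`|u| < κ/β`, the HT file `…HubbardHighTemperatureAnalytic` on the STRIP `|β Im u| < π/3` for `β ≤ betaHTc`).  Composition = the landed
`H10VitaliLine.H10TwoPointLimit_of_complexSausage_local` (p795316; parents p794110/p794945): bare corner + identity theorem + Vitali–Porter; NO termwise volume limits, NO two-volume rates,
NO power series at the target coupling.  Engine-level twin of the stub (finite-Matsubara family `g_{L,M}` bounded on `Ω`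
uniformly in `L, M`, the shape of `HubbardBetaUBound.norm_hubbardRatio_le_betaUMb`): `H10VitaliLine.H10TwoPointLimit_of_matsubaraSausage`
(§6 of `…VitaliLineNearZero`, with `…MatsubaraExtension.extension_of_matsubara_family` = Montel in `M`).  Sorry ONLY in the stub; the composition concludes the crux BY NAME.  Nothing here asserts the stub.
-/

namespace Summit.HubbardSuperconductivity.HubbardSuperconductivity.Cruxes.H10TwoPointLimit.Vitali

set_option linter.dupNamespace false

open Literature.MathematicalPhysics.QuantumLattice Literature.Probability.LatticeModels

/-- **STUB (the sausage bound — weakest landed form: LOCAL uniform bounds, R0-shaped agreement)** — for every `μ` in the analysis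
window, `β > 0`, sites/spins: an open preconnected `Ω ∋ 0` containing the real SEGMENT `[0, U]` of every admissible coupling
(`0 < U ≤ U₀`, `β ≤ e^{a/U}`), a threshold `L₀` and, for `L ≥ L₀`, holomorphic `G_L` on `Ω`, uniformly bounded NEAR EACH POINT of `Ω`
(bound and radius depending on the point, not on `L`), agreeing with `t ↦ ⟨c†_{xσ} c_{yσ'}⟩_{β,L,t,μ}` at SMALL non-zero real couplings
`0 < |t| < ρ_L` (the output shape of the tree's R0 core `…H10RungBetaUCorner.R0_core`, there on the disc `|u| < κ/β`). -/
theorem stub_k1_sausageBound :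
    ∃ U₀ a : ℝ, 0 < U₀ ∧ 0 < a ∧
      ∀ μ ∈ Set.Icc (-1 : ℝ) (-0.15), ∀ β : ℝ, 0 < β → ∀ (x y : Site 2) (σ σ' : Fin 2),
        ∃ Ω : Set ℂ, IsOpen Ω ∧ IsPreconnected Ω ∧ (0 : ℂ) ∈ Ω ∧
          (∀ U : ℝ, 0 < U → U ≤ U₀ → β ≤ Real.exp (a / U) → ∀ t ∈ Set.Icc (0 : ℝ) U, ((t : ℝ) : ℂ) ∈ Ω) ∧
          ∃ (L₀ : ℕ) (G : ℕ → ℂ → ℂ), (∀ L, L₀ ≤ L → DifferentiableOn ℂ (G L) Ω) ∧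
            (∀ z ∈ Ω, ∃ M : ℝ, ∃ r > 0, ∀ L, L₀ ≤ L → ∀ w ∈ Metric.ball z r ∩ Ω, ‖G L w‖ ≤ M) ∧
            (∀ L, L₀ ≤ L → ∃ ρ : ℝ, 0 < ρ ∧ ∀ t : ℝ, 0 < |t| → |t| < ρ →
              G L (t : ℂ) = hubbardThermalTwoPoint β t μ L x y σ σ') := by
  sorry

/-- **COMPOSITION — concludes crux K1 `H10TwoPointLimit` BY NAME** from the one stub, through the landed Vitali line
(`H10VitaliLine.H10TwoPointLimit_of_complexSausage_local`: bare corner + identity theorem + Vitali–Porter). -/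
theorem H10TwoPointLimit_of :
    Summit.HubbardSuperconductivity.HubbardSuperconductivity.Theses.KLProgramme.H10TwoPointLimit := by
  obtain ⟨U₀, a, hU₀, ha, h⟩ := stub_k1_sausageBound
  exact Summit.HubbardSuperconductivity.HubbardSuperconductivity.Theorems.H10VitaliLine.H10TwoPointLimit_of_complexSausage_local
    hU₀ ha h

end Summit.HubbardSuperconductivity.HubbardSuperconductivity.Cruxes.H10TwoPointLimit.Vitali
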